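import Summits.QuantumFields.YangMills.Theorems.ToronValleyVolumeLojasiewiczLocaliseQuaternion
import Summits.QuantumFields.YangMills.Theorems.ToronValleyVolumeLojasiewiczLocaliseRing
import Summits.QuantumFields.YangMills.Theses.ToronValleyVolume
import HarnessLib

/-!
# ★★★ Crux `ToronValleyVolume.LojasiewiczLocalise` (item stmt-QuantumFields-24498, LINE g15-B of ym-idea-4): the POLYNOMIAL ŁOJASIEWICZ LOCALISATION
# of the periodic deficit, with Hölder exponent `α = 1/2` and constant `5000·L⁸`

For a `2L`-slice ring history `P = (P₀,…,P_{2L−1}; g)` on `(ℤ/L)³` (`L ≥ 1`) with periodic action deficit `ε = F₀(P)` (✓`RingDeficit.ringDeficit L 0`), the squared chordal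
ring distance to the zero set `{F₀ = 0}` is at most `5000·L⁸·ε^{1/2}` (as soon as `ε ≤ (5000 L⁸)⁻¹`).  Mechanism (all errors accumulate ADDITIVELY — unitary telescoping —
so every constant is polynomial in `L`):
1. `F₀ = Σ_bonds (6L³ − timeCoupling) + Σ_slices S` (✓`log_seamChain_one`, ✓`log_transferKernel_one`): every kinetic bond deficit, the seam deficit and `S(P₀)` are `≤ 2ε`;
   per link, consecutive slices are `2√ε`-close (Frobenius), so every slice is within `4L√ε` of `P₀`, and the seam field `g` moves `P₀` by at most `ρ = 4L√ε` per link.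
2. Lane A's comb propagation (✓`fd_treeFix_combFlat_le`, ✓`fd_comm01/12/02_le`): in the comb gauge `V = treeFix P₀` every link is within `12L²√ε` of the comb-flat
   configuration `combFlat w`, `w = wrapReps P₀`, and the wraps almost commute (`≤ 20L²√ε`).
3. The conjugated seam field `s = t g t⁻¹` (`t = treeGauge P₀`) nearly stabilises `V`: it jumps by `≤ ρ` across tree edges, so `s ≈ c := s 0` within `3(L−1)ρ`
   (✓`fd_sub_base_le_of_treeEdge`), and on the three wrap edges (which end at the origin) `c` almost commutes with the wraps (`≤ 12L²√ε`).
4. ✓`exists_commuting_near_of_norm_comm_le`: the quadruple `(w₀,w₁,w₂,c)` is within `2√η`, `η = 20L²√ε`, of a COMMUTING quadruple `(w',c')`; the ring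
   `Q = (t⁻¹·combFlat w' on every slice; seam x ↦ t(x)⁻¹ c' t(x))` has `F₀(Q) = 0` (✓`wilsonAction_combFlat_eq_zero`, constant commuting gauge fixes `combFlat w'`).
5. Summing `2 − Re tr ≤ fd²` over `2L·3L³` slice links and `L³` seam sites gives `≤ 5000 L⁸ √ε`.
HONEST FRAMING: a classical (zero-ℏ) inequality for the lattice Wilson action on `L³ × 2L`; the sibling crux ⟨24497⟩ `ToronTubeVolumeLaw`, the leaf ⟨24141⟩
`PeriodicSoftness`, every rung and the Yang–Mills mass gap remain OPEN; no summit is proved by a line.  THEOREMS ONLY, no `sorry`.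
-/

set_option autoImplicit false

noncomputable section

open scoped Quaternion Matrix BigOperators
open Literature.MathematicalPhysics.QuantumFieldTheory hiding SU2
open Literature.MathematicalPhysics.QuantumLattice

namespace Summit.QuantumFields.YangMills.Theorems.ToronValleyVolume.Lojasiewicz

open Summit.QuantumFields.YangMills.Theorems.FemtoTransferGap
open Summit.QuantumFields.YangMills.Theorems.FemtoTransferGap.TT
open Summit.QuantumFields.YangMills.Theorems.FemtoTransferGap.TT.SectorSmooth
open Summit.QuantumFields.YangMills.Theorems.FemtoTransferGap.TwoLattice
open Summit.QuantumFields.YangMills.Theorems.FemtoTransferGap.TwoLattice.Flat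
open Summit.QuantumFields.YangMills.Theorems.FemtoTransferGap.TwoLattice.Cov
open Summit.QuantumFields.YangMills.Theorems.VirialFluxGap.RingDeficit

variable {L : ℕ} [NeZero L]

/-! ## §1 ★★ The flat comparison ring -/

/-- ★★ **A flat ring history near every small-deficit ring history.**  With `δ = √F₀(P)` and `μ = √(20L²δ)`: there is a ring history `Q` with `F₀(Q) = 0` whose
slices are within `4Lδ + 12L²δ + 2μ` of the slices of `P` on every link (Frobenius) and whose seam field is within `12L²δ + 2μ` of the seam field of `P` at every
site. [cite: Luscher1983, §2] -/
theorem exists_flat_ring_near (P : (Fin (2 * L - 1 + 1) → GaugeConfig 3 L SU2) × (Site 3 L → SU2)) :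
    ∃ Q : (Fin (2 * L - 1 + 1) → GaugeConfig 3 L SU2) × (Site 3 L → SU2),
      ringDeficit L (fun _ => false) Q = 0 ∧
      (∀ (i : Fin (2 * L - 1 + 1)) (e : Edge 3 L), fd (P.1 i e) (Q.1 i e) ≤
        4 * (L : ℝ) * Real.sqrt (ringDeficit L (fun _ => false) P) + 12 * (L : ℝ) ^ 2 * Real.sqrt (ringDeficit L (fun _ => false) P) +
          2 * Real.sqrt (20 * (L : ℝ) ^ 2 * Real.sqrt (ringDeficit L (fun _ => false) P))) ∧
      (∀ x : Site 3 L, fd (P.2 x) (Q.2 x) ≤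
        12 * (L : ℝ) ^ 2 * Real.sqrt (ringDeficit L (fun _ => false) P) + 2 * Real.sqrt (20 * (L : ℝ) ^ 2 * Real.sqrt (ringDeficit L (fun _ => false) P))) := by
  set δ := Real.sqrt (ringDeficit L (fun _ => false) P) with hδ
  have hδ0 : 0 ≤ δ := Real.sqrt_nonneg _
  have hL1 : (1 : ℝ) ≤ L := by exact_mod_cast NeZero.one_le
  have hL0 : (0 : ℝ) ≤ (L : ℝ) - 1 := by linarith
  set U : GaugeConfig 3 L SU2 := P.1 0 with hU
  set g : Site 3 L → SU2 := P.2 with hg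
  set ρ : ℝ := 4 * (L : ℝ) * δ with hρ
  have hρ0 : 0 ≤ ρ := by positivity
  -- inputs from `…LocaliseRing` §2
  have hslice : ∀ i e, fd (P.1 i e) (U e) ≤ 4 * (L : ℝ) * δ := fun i e => fd_slice_zero_le' P i e
  have hseam : ∀ e, fd (U e) (gaugeTransform g U e) ≤ ρ := fun e => fd_seam_zero_le P e
  have hS : Real.sqrt (2 * wilsonAction su2Rep U) ≤ 2 * δ := sqrt_two_action_le P
  -- comb gauge of slice 0
  set t : Site 3 L → SU2 := treeGauge U with ht
  have hV : treeFix U = gaugeTransform t U := rfl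
  set w : Fin 3 → SU2 := wrapReps U with hw
  have hVw : ∀ e, fd (treeFix U e) (combFlat w e) ≤ 12 * (L : ℝ) ^ 2 * δ := fun e => by
    refine (fd_treeFix_combFlat_le U e).trans ?_
    have h1 : ((L : ℝ) - 1) * ((6 * (L : ℝ) - 4) * Real.sqrt (2 * wilsonAction su2Rep U)) ≤ ((L : ℝ) - 1) * ((6 * (L : ℝ) - 4) * (2 * δ)) :=
      mul_le_mul_of_nonneg_left (mul_le_mul_of_nonneg_left hS (by linarith)) hL0
    nlinarith [h1]
  have hww : ∀ i j, fd (w i * w j * (w i)⁻¹ * (w j)⁻¹) 1 ≤ 20 * (L : ℝ) ^ 2 * δ := fun i j => by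
    refine (fd_comm_wrapReps_le U i j).trans ?_
    have hC : combC L ≤ 10 * (L : ℝ) ^ 2 := by unfold combC; nlinarith
    have hC0 : 0 ≤ combC L := le_trans zero_le_one one_le_combC
    calc combC L * Real.sqrt (2 * wilsonAction su2Rep U) ≤ combC L * (2 * δ) := mul_le_mul_of_nonneg_left hS hC0
      _ ≤ 10 * (L : ℝ) ^ 2 * (2 * δ) := mul_le_mul_of_nonneg_right hC (by positivity)
      _ = 20 * (L : ℝ) ^ 2 * δ := by ring
  -- the conjugated seam field nearly stabilises the comb-gauge slice
  set s : Site 3 L → SU2 := fun x => t x * g x * (t x)⁻¹ with hs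
  have hsV : ∀ e, fd (treeFix U e) (gaugeTransform s (treeFix U) e) ≤ ρ := fun e => by
    rw [hV, hs, gaugeTransform_conj_eq, fd_gaugeTransform_apply]; exact hseam e
  have hjump : ∀ e : Edge 3 L, treeEdge e = true → fd (s (e.1.shift e.2)) (s e.1) ≤ ρ := by
    intro e he
    have h1 := hsV e
    rw [treeFix_eq_one_of_treeEdge U he] at h1
    have e1 : gaugeTransform s (treeFix U) e = s e.1 * (s (e.1.shift e.2))⁻¹ := by
      rw [show gaugeTransform s (treeFix U) e = s e.1 * treeFix U e * (s (e.1.shift e.2))⁻¹ from rfl, treeFix_eq_one_of_treeEdge U he, mul_one]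
    rw [e1, fd_comm, fd_mul_inv_one] at h1
    rwa [fd_comm]
  set c : SU2 := s 0 with hc
  have hsc : ∀ x, fd (s x) c ≤ 3 * ((L : ℝ) - 1) * ρ := fun x => by
    have := fd_sub_base_le_of_treeEdge hρ0 hjump x
    rwa [hc]
  have hcw : ∀ k : Fin 3, fd (c * w k * c⁻¹ * (w k)⁻¹) 1 ≤ 12 * (L : ℝ) ^ 2 * δ := by
    intro k
    set m : Site 3 L := mk3 (if k = 0 then (-1 : ZMod L) else 0) (if k = 1 then (-1 : ZMod L) else 0) (if k = 2 then (-1 : ZMod L) else 0) with hm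
    have hwk : w k = treeFix U (m, k) := by rw [hw, wrapReps_eq]
    have hshift : m.shift k = 0 := wrapEdge_shift k
    have h1 := hsV (m, k)
    have e1 : gaugeTransform s (treeFix U) (m, k) = s m * treeFix U (m, k) * c⁻¹ := by
      rw [show gaugeTransform s (treeFix U) (m, k) = s m * treeFix U (m, k) * (s (m.shift k))⁻¹ from rfl, hshift]
    rw [e1, ← hwk] at h1
    -- `fd (w k) (c w c⁻¹) ≤ fd (w k) (s m w c⁻¹) + fd (s m w c⁻¹) (c w c⁻¹) = ρ + fd (s m) c`
    have h2 : fd (s m * w k * c⁻¹) (c * w k * c⁻¹) = fd (s m) c := by rw [fd_mul_right, fd_mul_right]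
    have h3 := hsc m
    rw [fd_mul_inv_one, fd_comm]
    calc fd (w k) (c * w k * c⁻¹) ≤ fd (w k) (s m * w k * c⁻¹) + fd (s m * w k * c⁻¹) (c * w k * c⁻¹) := fd_triangle _ _ _
      _ ≤ ρ + 3 * ((L : ℝ) - 1) * ρ := by rw [h2]; exact add_le_add h1 h3
      _ ≤ 12 * (L : ℝ) ^ 2 * δ := by rw [hρ]; nlinarith
  -- the quadruple (wraps, c) almost commutes
  let X : Option (Fin 3) → SU2 := fun o => Option.elim o c w
  have hXs : ∀ k : Fin 3, X (some k) = w k := fun k => rfl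
  have hXn : X none = c := rfl
  have hinv : ∀ a b : SU2, fd (b * a * b⁻¹ * a⁻¹) 1 = fd (a * b * a⁻¹ * b⁻¹) 1 := fun a b => by
    rw [show b * a * b⁻¹ * a⁻¹ = (a * b * a⁻¹ * b⁻¹)⁻¹ by group, ← fd_inv, inv_inv, inv_one]
  have hcomm : ∀ i j, ‖su2Quat (X i) * su2Quat (X j) - su2Quat (X j) * su2Quat (X i)‖ ≤ 20 * (L : ℝ) ^ 2 * δ := by
    intro i j
    refine (norm_quat_comm_le_fd (X i) (X j)).trans ?_
    rcases i with _ | i <;> rcases j with _ | j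
    · rw [hXn, mul_inv_cancel_right, mul_inv_cancel, fd_self]; positivity
    · rw [hXn, hXs]; exact (hcw j).trans (by nlinarith)
    · rw [hXn, hXs, hinv]; exact (hcw i).trans (by nlinarith)
    · rw [hXs, hXs]; exact hww i j
  have hη0 : 0 ≤ 20 * (L : ℝ) ^ 2 * δ := by positivity
  obtain ⟨y, hy1, hyc, hyd⟩ := exists_commuting_near_of_norm_comm_le (fun o => su2Quat (X o)) hη0 (fun o => norm_su2Quat _) hcomm
  obtain ⟨Y, hYq, hYc⟩ := exists_su2_family_of_unit_quaternions y hy1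
  have hYcomm : ∀ i j, Y i * Y j = Y j * Y i := fun i j => hYc i j (hyc i j)
  have hXY : ∀ o, fd (X o) (Y o) ≤ 2 * Real.sqrt (20 * (L : ℝ) ^ 2 * δ) := fun o => by
    refine (fd_le_two_mul_norm_su2Quat_sub (X o) (Y o)).trans ?_
    rw [hYq]; linarith [hyd o]
  -- the flat ring
  set h' : Fin 3 → SU2 := fun k => Y (some k) with hh'
  set c' : SU2 := Y none with hc'
  have hh'c : ∀ i j, h' i * h' j = h' j * h' i := fun i j => hYcomm _ _
  have hc'h : ∀ k, c' * h' k = h' k * c' := fun k => hYcomm _ _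
  set F : GaugeConfig 3 L SU2 := combFlat h' with hF
  have hSF : wilsonAction su2Rep F = 0 := wilsonAction_combFlat_eq_zero hh'c
  refine ⟨(fun _ => gaugeTransform t⁻¹ F, fun x => (t x)⁻¹ * c' * t x), ?_, ?_, ?_⟩
  · -- deficit zero
    rw [ringDeficit_eq_sums, twist3_false]
    dsimp only
    have hseamQ : gaugeTransform (fun x => (t x)⁻¹ * c' * t x) (gaugeTransform t⁻¹ F) = gaugeTransform t⁻¹ F := by
      rw [gaugeTransform_gaugeTransform]
      have e1 : ((fun x => (t x)⁻¹ * c' * t x) * t⁻¹ : Site 3 L → SU2) = t⁻¹ * fun _ => c' := by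
        funext x; simp only [Pi.mul_apply, Pi.inv_apply, mul_inv_cancel_right]
      rw [e1, ← gaugeTransform_gaugeTransform, gaugeTransform_const_combFlat_of_comm hc'h]
    rw [hseamQ, timeCoupling_deficit_self, wilsonAction_gaugeTransform, hSF]
    simp
  · -- slices
    intro i e
    have e1 : fd (P.1 i e) (gaugeTransform t⁻¹ F e) = fd (gaugeTransform t (P.1 i) e) (F e) := by
      have h := fd_gaugeTransform_apply t (P.1 i) (gaugeTransform t⁻¹ F) e
      rw [gaugeTransform_gaugeTransform_inv] at h
      exact h.symm
    rw [e1]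
    have h1 : fd (gaugeTransform t (P.1 i) e) (gaugeTransform t U e) ≤ 4 * (L : ℝ) * δ := by rw [fd_gaugeTransform_apply]; exact hslice i e
    have h2 := hVw e
    have h3 : fd (combFlat w e) (F e) ≤ 2 * Real.sqrt (20 * (L : ℝ) ^ 2 * δ) := by
      rw [hF, combFlat_apply, combFlat_apply]
      split_ifs with hx
      · have := hXY (some e.2); rwa [hXs] at this
      · rw [fd_self]; positivity
    calc fd (gaugeTransform t (P.1 i) e) (F e)
        ≤ fd (gaugeTransform t (P.1 i) e) (gaugeTransform t U e) + (fd (gaugeTransform t U e) (combFlat w e) + fd (combFlat w e) (F e)) :=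
          (fd_triangle _ _ _).trans (add_le_add le_rfl (fd_triangle _ _ _))
      _ ≤ 4 * (L : ℝ) * δ + (12 * (L : ℝ) ^ 2 * δ + 2 * Real.sqrt (20 * (L : ℝ) ^ 2 * δ)) := add_le_add h1 (add_le_add (hV ▸ h2) h3)
      _ = 4 * (L : ℝ) * δ + 12 * (L : ℝ) ^ 2 * δ + 2 * Real.sqrt (20 * (L : ℝ) ^ 2 * δ) := by ring
  · -- seam
    intro x
    have e0 : t x * ((t x)⁻¹ * c' * t x) * (t x)⁻¹ = c' := by
      simp only [mul_assoc, mul_inv_cancel_left, mul_inv_cancel, mul_one]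
    have e1 : fd (g x) ((t x)⁻¹ * c' * t x) = fd (s x) c' := by
      rw [hs]; dsimp only
      conv_rhs => rw [← e0]
      rw [fd_mul_right, fd_mul_left]
    rw [e1]
    have h1 := hsc x
    have h2 : fd c c' = fd (X none) (Y none) := rfl
    have h3 := hXY none
    calc fd (s x) c' ≤ fd (s x) c + fd c c' := fd_triangle _ _ _
      _ ≤ 3 * ((L : ℝ) - 1) * ρ + 2 * Real.sqrt (20 * (L : ℝ) ^ 2 * δ) := add_le_add h1 (h2 ▸ h3)
      _ ≤ 12 * (L : ℝ) ^ 2 * δ + 2 * Real.sqrt (20 * (L : ℝ) ^ 2 * δ) := by rw [hρ]; nlinarith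


/-! ## §2 ★★★ The crux -/

/-- Squared quaternion distance is dominated by the squared Frobenius distance. [folklore] -/
theorem norm_su2Quat_sub_sq_le_fd_sq (V W : SU2) : ‖su2Quat V - su2Quat W‖ ^ 2 ≤ fd V W ^ 2 :=
  pow_le_pow_left₀ (norm_nonneg _) (norm_su2Quat_sub_le_fd V W) 2

/-- The elementary arithmetic of the constants: with `δ ≤ 1`, `μ = √(20L²δ)`, `B₁ = 4Lδ + 12L²δ + 2μ`, `B₂ = 12L²δ + 2μ`:
`2L·3L³·B₁² + L³·B₂² ≤ 5000·L⁸·δ`. [folklore] -/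
theorem constants_arith {Lr δ : ℝ} (hL : 1 ≤ Lr) (hδ0 : 0 ≤ δ) (hδ1 : δ ≤ 1) :
    2 * Lr * (3 * Lr ^ 3) * (4 * Lr * δ + 12 * Lr ^ 2 * δ + 2 * Real.sqrt (20 * Lr ^ 2 * δ)) ^ 2 +
      Lr ^ 3 * (12 * Lr ^ 2 * δ + 2 * Real.sqrt (20 * Lr ^ 2 * δ)) ^ 2 ≤ 5000 * Lr ^ 8 * δ := by
  set τ := Real.sqrt δ with hτ
  have hτ0 : 0 ≤ τ := Real.sqrt_nonneg _
  have hτ2 : τ ^ 2 = δ := Real.sq_sqrt hδ0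
  have hτ1 : τ ≤ 1 := by rw [hτ]; exact Real.sqrt_le_one.mpr hδ1
  have hδτ : δ ≤ τ := by nlinarith
  have hμ : Real.sqrt (20 * Lr ^ 2 * δ) ≤ 5 * Lr * τ := by
    have h1 : 20 * Lr ^ 2 * δ ≤ (5 * Lr * τ) ^ 2 := by nlinarith [hτ2]
    calc Real.sqrt (20 * Lr ^ 2 * δ) ≤ Real.sqrt ((5 * Lr * τ) ^ 2) := Real.sqrt_le_sqrt h1
      _ = 5 * Lr * τ := Real.sqrt_sq (by positivity)
  have hμ0 : 0 ≤ Real.sqrt (20 * Lr ^ 2 * δ) := Real.sqrt_nonneg _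
  have hLL : Lr ≤ Lr ^ 2 := by nlinarith
  have hB1 : 4 * Lr * δ + 12 * Lr ^ 2 * δ + 2 * Real.sqrt (20 * Lr ^ 2 * δ) ≤ 26 * Lr ^ 2 * τ := by
    nlinarith [mul_le_mul_of_nonneg_left hδτ (by positivity : (0:ℝ) ≤ 4 * Lr), mul_le_mul_of_nonneg_left hδτ (by positivity : (0:ℝ) ≤ 12 * Lr ^ 2),
      mul_le_mul_of_nonneg_right hLL hτ0]
  have hB2 : 12 * Lr ^ 2 * δ + 2 * Real.sqrt (20 * Lr ^ 2 * δ) ≤ 22 * Lr ^ 2 * τ := by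
    nlinarith [mul_le_mul_of_nonneg_left hδτ (by positivity : (0:ℝ) ≤ 12 * Lr ^ 2), mul_le_mul_of_nonneg_right hLL hτ0]
  have hB10 : 0 ≤ 4 * Lr * δ + 12 * Lr ^ 2 * δ + 2 * Real.sqrt (20 * Lr ^ 2 * δ) := by positivity
  have hB20 : 0 ≤ 12 * Lr ^ 2 * δ + 2 * Real.sqrt (20 * Lr ^ 2 * δ) := by positivity
  have hsq1 : (4 * Lr * δ + 12 * Lr ^ 2 * δ + 2 * Real.sqrt (20 * Lr ^ 2 * δ)) ^ 2 ≤ (26 * Lr ^ 2 * τ) ^ 2 := pow_le_pow_left₀ hB10 hB1 2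
  have hsq2 : (12 * Lr ^ 2 * δ + 2 * Real.sqrt (20 * Lr ^ 2 * δ)) ^ 2 ≤ (22 * Lr ^ 2 * τ) ^ 2 := pow_le_pow_left₀ hB20 hB2 2
  have e1 : (26 * Lr ^ 2 * τ) ^ 2 = 676 * Lr ^ 4 * δ := by rw [← hτ2]; ring
  have e2 : (22 * Lr ^ 2 * τ) ^ 2 = 484 * Lr ^ 4 * δ := by rw [← hτ2]; ring
  rw [e1] at hsq1; rw [e2] at hsq2
  have hL3 : Lr ^ 3 ≤ Lr ^ 4 := by nlinarith [pow_pos (by linarith : (0:ℝ) < Lr) 3]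
  have h7 : Lr ^ 3 * (484 * Lr ^ 4 * δ) ≤ 484 * Lr ^ 8 * δ := by nlinarith [mul_nonneg (mul_nonneg (by norm_num : (0:ℝ) ≤ 484) (pow_nonneg (by linarith : (0:ℝ) ≤ Lr) 4)) hδ0]
  calc 2 * Lr * (3 * Lr ^ 3) * (4 * Lr * δ + 12 * Lr ^ 2 * δ + 2 * Real.sqrt (20 * Lr ^ 2 * δ)) ^ 2 +
        Lr ^ 3 * (12 * Lr ^ 2 * δ + 2 * Real.sqrt (20 * Lr ^ 2 * δ)) ^ 2
      ≤ 2 * Lr * (3 * Lr ^ 3) * (676 * Lr ^ 4 * δ) + Lr ^ 3 * (484 * Lr ^ 4 * δ) :=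
        add_le_add (mul_le_mul_of_nonneg_left hsq1 (by positivity)) (mul_le_mul_of_nonneg_left hsq2 (by positivity))
    _ ≤ 5000 * Lr ^ 8 * δ := by nlinarith [h7, pow_nonneg (by linarith : (0:ℝ) ≤ Lr) 8]

/-- ★★★ **Crux `LojasiewiczLocalise` (item stmt-QuantumFields-24498): polynomial Łojasiewicz localisation of the periodic deficit with Hölder exponent `½`.**
For every `L ≥ 1` and every ring history `P` with `F₀(P) ≤ (5000·L⁸)⁻¹`, the squared chordal ring distance from `P` to `{F₀ = 0}` is at most `5000·L⁸·F₀(P)^{1/2}`.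
[cite: Luscher1983, §2] -/
theorem lojasiewiczLocalise_holds : Summit.QuantumFields.YangMills.Theses.ToronValleyVolume.LojasiewiczLocalise := by
  refine ⟨1 / 2, by norm_num, by norm_num, 5000, by norm_num, 8, by norm_num, 1, ?_⟩
  intro L _ _ P hP
  have h8 : ((L : ℝ) ^ (8 : ℝ)) = (L : ℝ) ^ (8 : ℕ) := by
    rw [show (8 : ℝ) = ((8 : ℕ) : ℝ) by norm_num, Real.rpow_natCast]
  rw [h8] at hP ⊢
  set ε := ringDeficit L (fun _ => false) P with hε
  have hε0 : 0 ≤ ε := ringDeficit_nonneg _ _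
  have hL1 : (1 : ℝ) ≤ L := by exact_mod_cast NeZero.one_le
  have hL8 : (1 : ℝ) ≤ 5000 * (L : ℝ) ^ 8 := by nlinarith [one_le_pow₀ (n := 8) hL1]
  have hε1 : ε ≤ 1 := hP.trans (inv_le_one_of_one_le₀ hL8)
  set δ := Real.sqrt ε with hδ
  have hδ0 : 0 ≤ δ := Real.sqrt_nonneg _
  have hδ1 : δ ≤ 1 := Real.sqrt_le_one.mpr hε1
  have hα : ε ^ (1 / 2 : ℝ) = δ := by rw [hδ, Real.sqrt_eq_rpow]
  rw [hα]
  -- the flat comparison ring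
  obtain ⟨Q, hQ0, hQ1, hQ2⟩ := exists_flat_ring_near P
  set B₁ := 4 * (L : ℝ) * δ + 12 * (L : ℝ) ^ 2 * δ + 2 * Real.sqrt (20 * (L : ℝ) ^ 2 * δ) with hB₁
  set B₂ := 12 * (L : ℝ) ^ 2 * δ + 2 * Real.sqrt (20 * (L : ℝ) ^ 2 * δ) with hB₂
  -- the value at `Q`
  have hval : (∑ i : Fin (2 * L - 1 + 1), (6 * (L : ℝ) ^ 3 - timeCoupling su2Rep (P.1 i) (Q.1 i))) +
      ∑ x : Site 3 L, (2 - ((su2Rep (P.2 x * (Q.2 x)⁻¹)).trace).re) ≤ 5000 * (L : ℝ) ^ 8 * δ := by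
    have hs1 : ∀ i : Fin (2 * L - 1 + 1), 6 * (L : ℝ) ^ 3 - timeCoupling su2Rep (P.1 i) (Q.1 i) ≤ 3 * (L : ℝ) ^ 3 * B₁ ^ 2 := fun i => by
      rw [timeCoupling_deficit_eq]
      calc ∑ e : Edge 3 L, ‖su2Quat (P.1 i e) - su2Quat (Q.1 i e)‖ ^ 2 ≤ ∑ _e : Edge 3 L, B₁ ^ 2 :=
            Finset.sum_le_sum fun e _ => (norm_su2Quat_sub_sq_le_fd_sq _ _).trans (pow_le_pow_left₀ (frobNorm_nonneg _) (hQ1 i e) 2)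
        _ = 3 * (L : ℝ) ^ 3 * B₁ ^ 2 := by rw [Finset.sum_const, Finset.card_univ, nsmul_eq_mul, ConstTube.card_edge_three L]
    have hs2 : ∀ x : Site 3 L, 2 - ((su2Rep (P.2 x * (Q.2 x)⁻¹)).trace).re ≤ B₂ ^ 2 := fun x => by
      rw [ConstTube.re_trace_su2Rep_mul_inv_eq_norm]
      have := (norm_su2Quat_sub_sq_le_fd_sq (P.2 x) (Q.2 x)).trans (pow_le_pow_left₀ (frobNorm_nonneg _) (hQ2 x) 2)
      linarith
    have hcardI : (Fintype.card (Fin (2 * L - 1 + 1)) : ℝ) = 2 * (L : ℝ) := by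
      rw [Fintype.card_fin]
      have hL : 1 ≤ L := NeZero.one_le
      rw [show 2 * L - 1 + 1 = 2 * L by omega]; push_cast; ring
    have hcardS : (Fintype.card (Site 3 L) : ℝ) = (L : ℝ) ^ 3 := by
      rw [Fintype.card_pi, Finset.prod_const, Finset.card_univ, Fintype.card_fin, ZMod.card]; push_cast; ring
    have hA : (∑ i : Fin (2 * L - 1 + 1), (6 * (L : ℝ) ^ 3 - timeCoupling su2Rep (P.1 i) (Q.1 i))) ≤ 2 * (L : ℝ) * (3 * (L : ℝ) ^ 3) * B₁ ^ 2 := by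
      calc (∑ i : Fin (2 * L - 1 + 1), (6 * (L : ℝ) ^ 3 - timeCoupling su2Rep (P.1 i) (Q.1 i))) ≤ ∑ _i : Fin (2 * L - 1 + 1), 3 * (L : ℝ) ^ 3 * B₁ ^ 2 :=
            Finset.sum_le_sum fun i _ => hs1 i
        _ = 2 * (L : ℝ) * (3 * (L : ℝ) ^ 3) * B₁ ^ 2 := by rw [Finset.sum_const, Finset.card_univ, nsmul_eq_mul, hcardI]; ring
    have hB : ∑ x : Site 3 L, (2 - ((su2Rep (P.2 x * (Q.2 x)⁻¹)).trace).re) ≤ (L : ℝ) ^ 3 * B₂ ^ 2 := by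
      calc ∑ x : Site 3 L, (2 - ((su2Rep (P.2 x * (Q.2 x)⁻¹)).trace).re) ≤ ∑ _x : Site 3 L, B₂ ^ 2 := Finset.sum_le_sum fun x _ => hs2 x
        _ = (L : ℝ) ^ 3 * B₂ ^ 2 := by rw [Finset.sum_const, Finset.card_univ, nsmul_eq_mul, hcardS]
    have harith := constants_arith hL1 hδ0 hδ1
    rw [← hB₁, ← hB₂] at harith
    linarith
  -- `sInf ≤` the value at `Q`
  refine le_trans (csInf_le ?_ ⟨Q, hQ0, rfl⟩) hval
  refine ⟨0, ?_⟩
  rintro _ ⟨Q', -, rfl⟩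
  exact add_nonneg (Finset.sum_nonneg fun i _ => by linarith [timeCoupling_su2Rep_le (P.1 i) (Q'.1 i)])
    (Finset.sum_nonneg fun x _ => by
      rw [ConstTube.re_trace_su2Rep_mul_inv_eq_norm]; nlinarith [sq_nonneg ‖su2Quat (P.2 x) - su2Quat (Q'.2 x)‖])

end Summit.QuantumFields.YangMills.Theorems.ToronValleyVolume.Lojasiewicz

namespace Summit.QuantumFields.YangMills.Theorems.ToronValleyVolume

/-- ★★★ **The crux `ToronValleyVolume.LojasiewiczLocalise` by name** (item stmt-QuantumFields-24498): `α = 1/2`, `K = 5000`, `q = 8`, `L₀ = 1`.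
[cite: Luscher1983, §2] -/
theorem lojasiewiczLocalise_proof : Summit.QuantumFields.YangMills.Theses.ToronValleyVolume.LojasiewiczLocalise :=
  Lojasiewicz.lojasiewiczLocalise_holds

end Summit.QuantumFields.YangMills.Theorems.ToronValleyVolume

end
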